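import Literature.Geometry.Lorentzian.ChartLaplacian
import Literature.Geometry.Lorentzian.MeanCurvatureRegularity
import HarnessLib

/-!
# The gradient of a function as a differentiable section

For a `C^∞` metric `g` on `M` and `F : M → ℝ` of class `C²` at `p`, the gradient section
`y ↦ grad F(y) = ♯(dF_y)` (`PseudoRiemannianMetric.sharp` of the differential `mvfderiv`) has a
differentiable lift to `TM` at `p` (`mdifferentiableAt_sharp_mvfderiv`): on the chart domain of
`p` it is the frame combination `∑ₗ (∑ₖ dF(∂ₖ) 𝒢^{kl}) ∂ₗ` (`eq_sum_gram_inv_smul_localFrame`)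
with differentiable coefficients (`contMDiffAt_mvfderiv_localFrame`: the partial derivatives
`y ↦ dF_y(∂ᵢ)` of a `C²` function are `C¹`; `contMDiffAt_matrix_inv`). Used for the evolution of
the second fundamental form under inverse mean curvature flow (the Hessian term of
Huisken–Ilmanen's (1.3)).

Everything is proved; there are no definitions and no named facts.

## References

* B. O'Neill, *Semi-Riemannian geometry*, Academic Press 1983, Ch. 3, Def. 3.9 ff. (gradient).
-/

noncomputable section

open Bundle Set Function Filter Manifold
open scoped Manifold ContDiff Topology

namespace Literature.Geometry.Lorentzian

variable {E : Type*} [NormedAddCommGroup E] [NormedSpace ℝ E] {H : Type*} [TopologicalSpace H]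
  {I : ModelWithCorners ℝ E H} {M : Type*} [TopologicalSpace M] [ChartedSpace H M]
  [IsManifold I ∞ M]

namespace PseudoRiemannianMetric

variable [FiniteDimensional ℝ E] [I.Boundaryless]
  (g : PseudoRiemannianMetric I ∞ E (TangentSpace I : M → Type _))
  {ι : Type*} [Fintype ι] [DecidableEq ι] (b : Module.Basis ι ℝ E) {x₀ p : M}

omit [FiniteDimensional ℝ E] [Fintype ι] [DecidableEq ι] in
/-- **Partial derivatives of a `C²` function are `C¹`.** For `F : M → ℝ` of class `C²` at a point
`p` of the chart domain of `x₀`, the function `y ↦ dF_y(∂ᵢ|_y)` (`∂ᵢ` the coordinate frame of the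
chart at `x₀`) is `C¹` at `p`: in the chart it is `D(F ∘ φ⁻¹)(φ y) bᵢ`
(`mvfderiv_apply_localFrame`).
[folklore] -/
theorem contMDiffAt_mvfderiv_localFrame {F : M → ℝ} (hp : p ∈ (chartAt H x₀).source)
    (hF : CMDiffAt 2 F p) (i : ι) :
    ContMDiffAt I 𝓘(ℝ, ℝ) 1
      (fun y ↦ mvfderiv I F y ((trivializationAt E (TangentSpace I) x₀).localFrame b i y)) p := by
  -- `F ∘ φ⁻¹` is `C²` at `φ p`
  have hz : extChartAt I x₀ p ∈ (extChartAt I x₀).target :=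
    (extChartAt I x₀).map_source (by rwa [extChartAt_source])
  have hsymm : ContMDiffAt 𝓘(ℝ, E) I 2 (extChartAt I x₀).symm (extChartAt I x₀ p) :=
    ((contMDiffOn_extChartAt_symm (n := ∞) x₀).contMDiffAt
      ((isOpen_extChartAt_target x₀).mem_nhds hz)).of_le (by exact WithTop.coe_le_coe.2 le_top)
  have hp' : (extChartAt I x₀).symm (extChartAt I x₀ p) = p := (extChartAt I x₀).left_inv
    (by rwa [extChartAt_source])
  have hcomp : ContMDiffAt 𝓘(ℝ, E) 𝓘(ℝ, ℝ) 2 (F ∘ (extChartAt I x₀).symm) (extChartAt I x₀ p) :=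
    (hp' ▸ hF).comp _ hsymm
  have hcd : ContDiffAt ℝ 2 (F ∘ (extChartAt I x₀).symm) (extChartAt I x₀ p) :=
    contMDiffAt_iff_contDiffAt.1 hcomp
  have hfd : ContDiffAt ℝ 1 (fun z ↦ fderiv ℝ (F ∘ (extChartAt I x₀).symm) z (b i))
      (extChartAt I x₀ p) :=
    (hcd.fderiv_right (m := 1) le_rfl).clm_apply contDiffAt_const
  have h1 : ContMDiffAt I 𝓘(ℝ, ℝ) 1
      (fun y ↦ fderiv ℝ (F ∘ (extChartAt I x₀).symm) (extChartAt I x₀ y) (b i)) p :=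
    hfd.contMDiffAt.comp p (contMDiffAt_extChartAt' (n := 1) hp)
  -- near `p`, the two functions agree
  have hev : ∀ᶠ y in 𝓝 p, y ∈ (chartAt H x₀).source ∧ CMDiffAt 2 F y :=
    Filter.Eventually.and ((chartAt H x₀).open_source.mem_nhds hp)
      ((contMDiffAt_iff_contMDiffAt_nhds (by decide)).1 hF)
  refine h1.congr_of_eventuallyEq ?_
  filter_upwards [hev] with y hy
  exact mvfderiv_apply_localFrame b hy.1 (hy.2.mdifferentiableAt (by decide)) i

/-- **The gradient of a `C²` function is a differentiable section.** For `F : M → ℝ` of class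
`C²` at `p`, the gradient section `y ↦ grad F (y) = ♯(dF_y)` (`sharp` of the differential) has
a differentiable lift to `TM` at `p`: on the chart domain of `p`,
`grad F = ∑ₗ (∑ₖ dF(∂ₖ) 𝒢^{kl}) ∂ₗ` (`eq_sum_gram_inv_smul_localFrame`, `val_sharp_apply`) with
differentiable coefficients. O'Neill 1983, Ch. 3, Def. 3.9 ff. (gradient).
[cite: ONeill1983, Ch. 3, Def. 3.9] -/
theorem mdifferentiableAt_sharp_mvfderiv [CompleteSpace E] {F : M → ℝ} (hF : CMDiffAt 2 F p) :
    MDiffAt (T% (fun y ↦ (g.sharp y (mvfderiv I F y).toLinearMap : TangentSpace I y))) p := by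
  classical
  set bE := Module.finBasis ℝ E with hbE
  have hp : p ∈ (chartAt H p).source := mem_chart_source H p
  have hI1 : IsManifold I (1 + 1) M := inferInstanceAs (IsManifold I 2 M)
  have hVB : ContMDiffVectorBundle 1 E (TangentSpace I : M → Type _) I :=
    TangentBundle.contMDiffVectorBundle
  -- the coefficient functions
  set c : Fin (Module.finrank ℝ E) → M → ℝ := fun l y ↦
    ∑ k, mvfderiv I F y ((trivializationAt E (TangentSpace I) p).localFrame bE k y) *
      (Matrix.of fun i j ↦ g.val y ((trivializationAt E (TangentSpace I) p).localFrame bE i y)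
        ((trivializationAt E (TangentSpace I) p).localFrame bE j y))⁻¹ k l with hc
  have hs : ∀ l, CMDiffAt 1 (T% ((trivializationAt E (TangentSpace I) p).localFrame bE l)) p :=
    fun l ↦ contMDiffAt_localFrame_of_mem 1 _ bE l (by simp)
  have hgram : ∀ i j, ContMDiffAt I 𝓘(ℝ, ℝ) 1 (fun y ↦ g.val y
      ((trivializationAt E (TangentSpace I) p).localFrame bE i y)
      ((trivializationAt E (TangentSpace I) p).localFrame bE j y)) p := fun i j ↦
    g.contMDiffAt_val_apply (by exact_mod_cast le_top) (hs i) (hs j)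
  have hdet : (Matrix.of fun i j ↦ g.val p
      ((trivializationAt E (TangentSpace I) p).localFrame bE i p)
      ((trivializationAt E (TangentSpace I) p).localFrame bE j p)).det ≠ 0 :=
    det_gram_localFrame_ne_zero _ g bE (by simp)
  have hcoef : ∀ l, MDifferentiableAt I 𝓘(ℝ, ℝ) (c l) p := fun l ↦ by
    refine (ContMDiffAt.sum fun k _ ↦ ?_).mdifferentiableAt one_ne_zero
    exact (contMDiffAt_mvfderiv_localFrame bE hp hF k).mul (contMDiffAt_matrix_inv hgram hdet k l)
  have hσ : ∀ l,
      MDiffAt (T% ((c l) • ((trivializationAt E (TangentSpace I) p).localFrame bE l))) p :=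
    fun l ↦ (hcoef l).smul_section ((hs l).mdifferentiableAt one_ne_zero)
  have hsum : MDiffAt (T% (∑ l, (c l) • ((trivializationAt E (TangentSpace I) p).localFrame bE l)))
      p := by
    have := MDifferentiableAt.sum_section (I := I) (E := (TangentSpace I : M → Type _))
      (s := Finset.univ) (t := fun l ↦ (c l) • ((trivializationAt E (TangentSpace I) p).localFrame
        bE l)) (x₀ := p) (fun l _ ↦ hσ l)
    convert this using 2
    ext
    · rfl
    · simp [Finset.sum_apply]
  -- near `p`, the gradient is that frame combination
  refine MDifferentiableAt.congr_of_eventuallyEq hsum ?_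
  filter_upwards [(chartAt H p).open_source.mem_nhds hp] with y hy
  show (TotalSpace.mk' E y (g.sharp y (mvfderiv I F y).toLinearMap) : TangentBundle I M) =
    TotalSpace.mk' E y ((∑ l, (c l) • ((trivializationAt E (TangentSpace I) p).localFrame bE l)) y)
  congr 1
  rw [eq_sum_gram_inv_smul_localFrame g bE hy (g.sharp y (mvfderiv I F y).toLinearMap)]
  simp only [hc, Finset.sum_apply, Pi.smul_apply', val_sharp_apply]
  rfl

end PseudoRiemannianMetric

end Literature.Geometry.Lorentzian

end
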